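import Literature.Topology.FourManifolds.GluingUniqueness
import Literature.Topology.FourManifolds.DehnSurgery
import HarnessLib

/-!
# Uniqueness of open multi-gluings; surgeries with the same tubular neighbourhoods agree

Companion to `GluingUniqueness.lean` (`Literature.Topology.FourManifolds.IsOpenGluing.nonempty_diffeomorph`: two open gluings
of the same two pieces along the same relation are diffeomorphic) and first step towards leaf (U)
`Literature.Topology.FourManifolds.FramedLink.IsSurgery.nonempty_diffeomorph` (uniqueness of Dehn surgery on a framed link) of
the decomposition of Kirby's theorem recorded in `KirbyMovesSurgery.lean` (this file does not
depend on that sibling).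

Kosinski (*Differential Manifolds* (1993), Ch. VI §1, proof of Thm (1.1)) equips an
identification space with "the unique structure for which the projections are diffeomorphisms";
§6 of the same chapter attaches several handles simultaneously. The relational integral Dehn
surgery `Literature.Topology.FourManifolds.IsIntegralSurgeryLink` of `DehnSurgery.lean` is such an identification space with
`1 + #ι` pieces: the link complement and one open solid torus per component, the solid tori
pairwise disjoint. Everything here is proved:

* `Literature.Topology.FourManifolds.exists_multiGlueMap`, `Literature.Topology.FourManifolds.contMDiff_multiGlueMap`, `Literature.Topology.FourManifolds.nonempty_diffeomorph_of_multiGluing`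
  — the comparison map `jA a ↦ jA' a`, `jBᵢ b ↦ jB'ᵢ b` between two multi-gluings of one copy
  of `A` and `ι` copies of `B` along the same relations is well defined (injectivity, pairwise
  disjointness of the `B`-images, compatibility of the identifications), smooth (descent of
  smoothness along an open immersion, `Literature.Topology.FourManifolds.contMDiffAt_of_comp_isImmersionAt` of
  `GluingUniqueness.lean`) and, with its analogue in the other direction, a diffeomorphism;
* `Literature.Link.IsSurgeryPresentation IY Y L ν` — the tail of `IsIntegralSurgeryLink` after the choice
  of the tubular neighbourhoods (`isIntegralSurgeryLink_iff_exists_isSurgeryPresentation` is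
  `Iff.rfl`), and `Literature.Topology.FourManifolds.Link.IsSurgeryPresentation.nonempty_diffeomorph` — **two surgeries on a
  link presented with the same oriented tubular neighbourhoods are diffeomorphic** (any two
  models, any two universes).

What remains for leaf (U) is the normalisation of the tubular neighbourhoods: two families of
pairwise disjoint oriented tubular neighbourhoods of `L` with the same framing integers present
the same surgeries (uniqueness of tubular neighbourhoods up to ambient isotopy, Hirsch §4.5
Thm 5.3, isotopy extension, and the fact that the meridian has infinite order in `H₁(S³ ∖ Kᵢ)`).

## References

* A. Kosinski, *Differential Manifolds*, Academic Press (1993), Ch. VI §1 (proof of Thm (1.1)),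
  §6. [cite: Kosinski1993, Ch. VI §1, proof of Thm (1.1)]
* D. Rolfsen, *Knots and Links* (1976), §9.F–G. [cite: Rolfsen1976, §9.F]
-/

open scoped Manifold ContDiff Topology
open Function Set

noncomputable section

namespace Literature.Topology.FourManifolds

/-! ## The comparison map between two multi-gluings -/

section GlueMap

variable {ι A B P P' : Type*} {jA : A → P} {jB : ι → B → P} {jA' : A → P'} {jB' : ι → B → P'}

/-- **The comparison map between two multi-gluings**, set-theoretic part. If
`P = jA(A) ∪ ⋃ᵢ jBᵢ(B)` with `jA`, `jBᵢ` injective and the `jBᵢ(B)` pairwise disjoint, and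
`jA' : A → P'`, `jB'ᵢ : B → P'` respect the identifications of `P`
(`jA a = jBᵢ b → jA' a = jB'ᵢ b`), then `jA a ↦ jA' a`, `jBᵢ b ↦ jB'ᵢ b` is a well defined map
`P → P'` (Kosinski, *Differential Manifolds*, VI.1, proof of (1.1), map `G`, for several handles
at once as in VI.6). [cite: Kosinski1993, Ch. VI §1, proof of Thm (1.1)] -/
theorem exists_multiGlueMap (hU : range jA ∪ ⋃ i, range (jB i) = univ)
    (hinjA : Injective jA) (hinjB : ∀ i, Injective (jB i))
    (hdisj : Pairwise fun i j ↦ Disjoint (range (jB i)) (range (jB j)))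
    (hR : ∀ i a b, jA a = jB i b → jA' a = jB' i b) :
    ∃ G : P → P', (∀ a, G (jA a) = jA' a) ∧ ∀ i b, G (jB i b) = jB' i b := by
  classical
  have hmem : ∀ p, p ∉ range jA → ∃ i, p ∈ range (jB i) := fun p hp ↦ by
    have := (eq_univ_iff_forall.1 hU p).resolve_left hp
    simpa only [mem_iUnion] using this
  refine ⟨fun p ↦ if h : p ∈ range jA then jA' (Classical.choose h)
    else jB' (Classical.choose (hmem p h))
      (Classical.choose (Classical.choose_spec (hmem p h))), fun a ↦ ?_, fun i b ↦ ?_⟩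
  · dsimp only
    rw [dif_pos (mem_range_self a)]
    exact congrArg jA' (hinjA (Classical.choose_spec (mem_range_self (f := jA) a)))
  · dsimp only
    by_cases h : jB i b ∈ range jA
    · rw [dif_pos h]
      exact hR _ _ _ (Classical.choose_spec h)
    · rw [dif_neg h]
      -- the chosen index is `i` (disjointness) and the chosen point is `b` (injectivity)
      have key : ∀ i₀ b₀, jB i₀ b₀ = jB i b → jB' i₀ b₀ = jB' i b := fun i₀ b₀ he ↦ by
        obtain rfl : i₀ = i := by
          by_contra hne
          exact Set.disjoint_left.1 (hdisj hne) ⟨_, he⟩ (mem_range_self b)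
        rw [hinjB _ he]
      exact key _ _ (Classical.choose_spec (Classical.choose_spec (hmem _ h)))

end GlueMap

/-! ## Uniqueness of open multi-gluings -/

section MultiGluing

variable {EA HA EB HB EP HP EP' HP' : Type*}
  [NormedAddCommGroup EA] [NormedSpace ℝ EA] [TopologicalSpace HA] {IA : ModelWithCorners ℝ EA HA}
  [NormedAddCommGroup EB] [NormedSpace ℝ EB] [TopologicalSpace HB] {IB : ModelWithCorners ℝ EB HB}
  [NormedAddCommGroup EP] [NormedSpace ℝ EP] [TopologicalSpace HP] {IP : ModelWithCorners ℝ EP HP}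
  [NormedAddCommGroup EP'] [NormedSpace ℝ EP'] [TopologicalSpace HP']
  {IP' : ModelWithCorners ℝ EP' HP'}
  {ι A B P P' : Type*} [TopologicalSpace A] [ChartedSpace HA A] [TopologicalSpace B]
  [ChartedSpace HB B]
  [TopologicalSpace P] [ChartedSpace HP P] [TopologicalSpace P'] [ChartedSpace HP' P']
  {jA : A → P} {jB : ι → B → P} {jA' : A → P'} {jB' : ι → B → P'}

/-- The comparison map `G : P → P'` between an open multi-gluing `P = jA(A) ∪ ⋃ᵢ jBᵢ(B)` (open
smooth embeddings covering `P`) and smooth maps `jA' = G ∘ jA`, `jB'ᵢ = G ∘ jBᵢ` is smooth: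
locally it is `jA' ∘ jA⁻¹` or `jB'ᵢ ∘ jBᵢ⁻¹` (descent of smoothness along an open immersion,
`contMDiffAt_of_comp_isImmersionAt`). Kosinski (1993), VI.1, proof of (1.1).
[cite: Kosinski1993, Ch. VI §1, proof of Thm (1.1)] -/
theorem contMDiff_multiGlueMap [IsManifold IP' ∞ P']
    (hA : Manifold.IsSmoothEmbedding IA IP ∞ jA) (hAo : IsOpen (range jA))
    (hB : ∀ i, Manifold.IsSmoothEmbedding IB IP ∞ (jB i) ∧ IsOpen (range (jB i)))
    (hU : range jA ∪ ⋃ i, range (jB i) = univ) (hA' : ContMDiff IA IP' ∞ jA')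
    (hB' : ∀ i, ContMDiff IB IP' ∞ (jB' i))
    {G : P → P'} (hGA : ∀ a, G (jA a) = jA' a) (hGB : ∀ i b, G (jB i b) = jB' i b) :
    ContMDiff IP IP' ∞ G := by
  intro p
  rcases eq_univ_iff_forall.1 hU p with ⟨a, rfl⟩ | hp
  · exact contMDiffAt_of_comp_isImmersionAt (hA.isImmersion.isImmersionAt a)
      (Topology.IsOpenEmbedding.isOpenMap ⟨hA.isEmbedding, hAo⟩) (hA' a) hGA
  · obtain ⟨i, b, rfl⟩ : ∃ i b, jB i b = p := by simpa only [mem_iUnion, mem_range] using hp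
    exact contMDiffAt_of_comp_isImmersionAt ((hB i).1.isImmersion.isImmersionAt b)
      (Topology.IsOpenEmbedding.isOpenMap ⟨(hB i).1.isEmbedding, (hB i).2⟩) (hB' i b) (hGB i)

/-- **Uniqueness of open multi-gluings.** Two manifolds `P`, `P'` which are both obtained by
gluing one copy of `A` and `ι` copies of `B` by open smooth embeddings with pairwise disjoint
`B`-images, along the same relations `Rᵢ` between `A` and the `i`-th copy of `B`, are
diffeomorphic: the comparison maps `jA a ↦ jA' a, jBᵢ b ↦ jB'ᵢ b` (`exists_multiGlueMap`) in both
directions are mutually inverse and smooth (`contMDiff_multiGlueMap`). The one-handle case is the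
tree's `IsOpenGluing.nonempty_diffeomorph`; this is Kosinski's uniqueness of the smooth structure
on an identification space ("the unique structure for which the projections are
diffeomorphisms"), Kosinski, *Differential Manifolds* (1993), Ch. VI §1, proof of Thm (1.1), and
§6 (several handles attached simultaneously). Only `P`, `P'` need to be `C^∞` manifolds.
[cite: Kosinski1993, Ch. VI §1, proof of Thm (1.1)] -/
theorem nonempty_diffeomorph_of_multiGluing [IsManifold IP ∞ P] [IsManifold IP' ∞ P']
    {R : ι → A → B → Prop}
    (hA : Manifold.IsSmoothEmbedding IA IP ∞ jA) (hAo : IsOpen (range jA))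
    (hB : ∀ i, Manifold.IsSmoothEmbedding IB IP ∞ (jB i) ∧ IsOpen (range (jB i)))
    (hU : range jA ∪ ⋃ i, range (jB i) = univ)
    (hdisj : Pairwise fun i j ↦ Disjoint (range (jB i)) (range (jB j)))
    (hR : ∀ i a b, jA a = jB i b ↔ R i a b)
    (hA' : Manifold.IsSmoothEmbedding IA IP' ∞ jA') (hAo' : IsOpen (range jA'))
    (hB' : ∀ i, Manifold.IsSmoothEmbedding IB IP' ∞ (jB' i) ∧ IsOpen (range (jB' i)))
    (hU' : range jA' ∪ ⋃ i, range (jB' i) = univ)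
    (hdisj' : Pairwise fun i j ↦ Disjoint (range (jB' i)) (range (jB' j)))
    (hR' : ∀ i a b, jA' a = jB' i b ↔ R i a b) : Nonempty (P ≃ₘ⟮IP, IP'⟯ P') := by
  have hRR' : ∀ i a b, jA a = jB i b → jA' a = jB' i b :=
    fun i a b hab ↦ (hR' i a b).2 ((hR i a b).1 hab)
  have hR'R : ∀ i a b, jA' a = jB' i b → jA a = jB i b :=
    fun i a b hab ↦ (hR i a b).2 ((hR' i a b).1 hab)
  obtain ⟨G, hGA, hGB⟩ := exists_multiGlueMap hU hA.isEmbedding.injective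
    (fun i ↦ (hB i).1.isEmbedding.injective) hdisj hRR'
  obtain ⟨G', hGA', hGB'⟩ := exists_multiGlueMap hU' hA'.isEmbedding.injective
    (fun i ↦ (hB' i).1.isEmbedding.injective) hdisj' hR'R
  refine ⟨{ toFun := G
            invFun := G'
            left_inv := fun p ↦ ?_
            right_inv := fun p ↦ ?_
            contMDiff_toFun := contMDiff_multiGlueMap hA hAo hB hU hA'.contMDiff
              (fun i ↦ (hB' i).1.contMDiff) hGA hGB
            contMDiff_invFun := contMDiff_multiGlueMap hA' hAo' hB' hU' hA.contMDiff
              (fun i ↦ (hB i).1.contMDiff) hGA' hGB' }⟩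
  · rcases eq_univ_iff_forall.1 hU p with ⟨a, rfl⟩ | hp
    · rw [hGA, hGA']
    · obtain ⟨i, b, rfl⟩ : ∃ i b, jB i b = p := by simpa only [mem_iUnion, mem_range] using hp
      rw [hGB, hGB']
  · rcases eq_univ_iff_forall.1 hU' p with ⟨a, rfl⟩ | hp
    · rw [hGA', hGA]
    · obtain ⟨i, b, rfl⟩ : ∃ i b, jB' i b = p := by simpa only [mem_iUnion, mem_range] using hp
      rw [hGB', hGB]

end MultiGluing

/-! ## Surgeries on a link presented with the same tubular neighbourhoods are diffeomorphic -/

section Surgery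

/-- Local notation: `𝔼 n` is the model Euclidean space `EuclideanSpace ℝ (Fin n)`. -/
local notation "𝔼 " n:arg => EuclideanSpace ℝ (Fin n)

/-- Local notation: `𝕊 n` is the unit sphere in `EuclideanSpace ℝ (Fin (n + 1))`. -/
local notation "𝕊 " n:arg => (Metric.sphere (0 : EuclideanSpace ℝ (Fin (n + 1))) 1)

variable {EY HY EY' HY' : Type*}
  [NormedAddCommGroup EY] [NormedSpace ℝ EY] [TopologicalSpace HY] {IY : ModelWithCorners ℝ EY HY}
  [NormedAddCommGroup EY'] [NormedSpace ℝ EY'] [TopologicalSpace HY']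
  {IY' : ModelWithCorners ℝ EY' HY'}
  {Y : Type*} [TopologicalSpace Y] [ChartedSpace HY Y]
  {Y' : Type*} [TopologicalSpace Y'] [ChartedSpace HY' Y']

/-- The manifold `Y` **is surgery on the link `L` presented with the tubular neighbourhoods `ν`**:
the data of `Literature.Topology.FourManifolds.IsIntegralSurgeryLink` after the choice of the oriented tubular neighbourhoods —
open smooth embeddings of the link complement and of one open solid torus per component into `Y`,
with pairwise disjoint solid tori, jointly covering `Y`, the `i`-th solid torus glued to the
complement along `Link.surgeryRel ν i`. Thus `IsIntegralSurgeryLink IY Y L m` says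
`∃ ν, (∀ i, (ν i).HasFraming (m i)) ∧ Pairwise (Disjoint on range ∘ ν) ∧
L.IsSurgeryPresentation IY Y ν` (`isIntegralSurgeryLink_iff_exists_isSurgeryPresentation`).
Rolfsen, *Knots and Links* (1976), §9.F–G; Gompf–Stipsicz (1999), §5.3. [cite: Rolfsen1976, §9.F] -/
def Link.IsSurgeryPresentation (IY : ModelWithCorners ℝ EY HY) (Y : Type*) [TopologicalSpace Y]
    [ChartedSpace HY Y] {ι : Type*} [Finite ι] (L : Link ι)
    (ν : ∀ i, Knot.TubularNbhd (L.component i)) : Prop :=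
  ∃ (jA : L.complement → Y) (jB : ι → solidTorus → Y),
    Manifold.IsSmoothEmbedding (𝓡 3) IY ∞ jA ∧ IsOpen (range jA) ∧
    (∀ i, Manifold.IsSmoothEmbedding (𝓘(ℝ, 𝔼 2).prod (𝓡 1)) IY ∞ (jB i) ∧
      IsOpen (range (jB i))) ∧
    range jA ∪ (⋃ i, range (jB i)) = univ ∧
    (Pairwise fun i j ↦ Disjoint (range (jB i)) (range (jB j))) ∧
    ∀ i a b, jA a = jB i b ↔ Link.surgeryRel ν i a b

/-- `IsIntegralSurgeryLink` unfolded through `Link.IsSurgeryPresentation` (by definition).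
[folklore] -/
theorem isIntegralSurgeryLink_iff_exists_isSurgeryPresentation {ι : Type*} [Finite ι]
    (L : Link ι) (m : ι → ℤ) : IsIntegralSurgeryLink IY Y L m ↔
      ∃ ν : ∀ i, Knot.TubularNbhd (L.component i), (∀ i, (ν i).HasFraming (m i)) ∧
        (Pairwise fun i j ↦ Disjoint (range (ν i)) (range (ν j))) ∧
        L.IsSurgeryPresentation IY Y ν :=
  Iff.rfl

/-- **Surgeries presented with the same tubular neighbourhoods are diffeomorphic.** If the
`C^∞` manifolds `Y` and `Y'` (possibly on different models and in different universes) are both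
surgery on the link `L` presented with the same oriented tubular neighbourhoods `ν`
(`Link.IsSurgeryPresentation`), then `Y ≃ₘ Y'`: both are open multi-gluings of the link
complement and of one solid torus per component along the same relations `Link.surgeryRel ν i`
(`nonempty_diffeomorph_of_multiGluing`). This is the assembly step of the uniqueness of Dehn
surgery on a framed link (`FramedLink.IsSurgery.nonempty_diffeomorph`, whose remaining content is
that two families of tubular neighbourhoods with the same framings present the same surgeries).
Rolfsen (1976), §9.F; Kosinski (1993), VI.1. [cite: Kosinski1993, Ch. VI §1, proof of Thm (1.1)] -/
theorem Link.IsSurgeryPresentation.nonempty_diffeomorph [IsManifold IY ∞ Y] [IsManifold IY' ∞ Y']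
    {ι : Type*} [Finite ι] {L : Link ι} {ν : ∀ i, Knot.TubularNbhd (L.component i)}
    (h : L.IsSurgeryPresentation IY Y ν) (h' : L.IsSurgeryPresentation IY' Y' ν) :
    Nonempty (Y ≃ₘ⟮IY, IY'⟯ Y') := by
  obtain ⟨jA, jB, hA, hAo, hB, hU, hdisj, hR⟩ := h
  obtain ⟨jA', jB', hA', hAo', hB', hU', hdisj', hR'⟩ := h'
  exact nonempty_diffeomorph_of_multiGluing hA hAo hB hU hdisj hR hA' hAo' hB' hU' hdisj' hR'

end Surgery

end Literature.Topology.FourManifolds
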